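import Summits.BirchSwinnertonDyer.BirchSwinnertonDyer.Theorems.EisensteinPrimesInertiaTorsionFiniteGeneric
import Summits.BirchSwinnertonDyer.Rank1Residual.X2.NonPrimitiveQuotientCorank
import Literature.NumberTheory.GaloisRepresentations.InertiaCohomologyInvariantsBound
import HarnessLib

/-!
# `#{x ∈ H¹(I_w(K_∞), M) : p·x = 0} ≤ #(M[p])^{I_{K_w}}` at a place `w ∤ p` of a `ℤ_p`-extension, for a
# GENERIC `p`-divisible discrete module `M` — the per-place corank bounds `c_w ≤ 1` / `c_w = 0`

Cell `bsd-eis`, seat `bsd-line-x1-p1` (LEAD, D-0154 row 4), crux 2 `GoodLatticeBDPValue`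
(stmt-BirchSwinnertonDyer-19032), line `halves` v14, stub `stub_imprimCorank` (`≤` half of the
`S`-relaxation corank identity, kernel). Tool theorems only (no definition, no named fact, no `sorry`).

The CARDINALITY refinement of k5-c2 g11's `InertiaTorsionFiniteGeneric` (which proves finiteness only):
for a number field `K`, a prime `p`, a discrete `Γ_K`-module `M` with open stabilisers (`hstab`),
`p`-divisible (`hdiv`), `M[p]` finite of `p`-power order (`hcard`), a `ℤ_p`-extension `κ` (`H = ker κ`)
and `w ∤ p`:
* §1 `natCard_discreteH1_inertia_torsionBy_le` — `#H¹(I_w, M[p]) ≤ #(M[p])^{I_{K_w}}` (Serre/Milne: the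
  tree's `natCard_continuousCohomology_one_absInertia_le_natCard_invariants`, inflated along
  `absInertia K_w ↠ inertia w`);
* §2 **`natCard_setOf_nsmul_eq_zero_discreteH1_inertiaIn_le`** — `#{x ∈ H¹(inertiaIn H w, M) : p x = 0}
  ≤ #(M[p])^{I_{K_w}}` (chain `H¹(inertiaIn H w, M) ↪ H¹(H ⊓ I_w, M)`, Kummer `H¹(H ⊓ I_w, M[p]) ↠
  H¹(H ⊓ I_w, M)[p]`, `H ⊓ I_w = I_w`);
* §3 the corank consequences for every subgroup `Y ≤ H¹(inertiaIn H w, M)`: `zpCorank Y p ≤ 1` when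
  `#M[p] = p` (`zpCorank_le_one_of_natCard_torsionBy_eq`), and `zpCorank Y p = 0` when the local
  inertia group has no non-zero fixed point on `M[p]` (`zpCorank_eq_zero_of_invariants_trivial`) —
  the per-place inputs `c_w` of `DatumSelmerQuotientCorankGeneric.zpCorank_quotient_le_sum`
  (Greenberg–Vatsal Prop. (2.4): `corank H¹(I_η, A)^{G_η} ≤ corank A^{I}`; ramified character ⇒ `0`).

References: [GreenbergVatsal2000] §2 pp. 17, 22–23 (Prop. (2.4)); [MilneADT2006] I Lemma 2.9;
[SerreLocalFields1979] IV §2, XIII §1; [KellerYin2024] Lemma 1.1.1 (arXiv:2402.12781v2 TeX L455–462).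
-/

set_option linter.dupNamespace false
set_option autoImplicit false

noncomputable section

open scoped Classical AddSubgroup

open CategoryTheory NumberField IsDedekindDomain Field
open Summit.BirchSwinnertonDyer.Rank1Residual
open Literature.NumberTheory.EllipticCurves Literature.NumberTheory.EllipticCurves.GreenbergSelmer
  Literature.NumberTheory.GaloisRepresentations
  Summit.BirchSwinnertonDyer.BirchSwinnertonDyer.Theorems.InertiaTorsionFiniteGeneric
  Summit.BirchSwinnertonDyer.Rank1Residual.X2.NonPrimitiveQuotientCorank

universe u

namespace Summit.BirchSwinnertonDyer.BirchSwinnertonDyer.Theorems.InertiaTorsionCardGeneric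

/-! ## §1. `#H¹(I_w, M[p]) ≤ #(M[p])^{I_{K_w}}` -/

section Local

variable {K : Type u} [Field K] [NumberField K] {M : Type u} [AddCommGroup M]
  [DistribMulAction (absoluteGaloisGroup K) M] [TopologicalSpace M] [DiscreteTopology M]
  (p : ℕ) (v : HeightOneSpectrum (𝓞 K))

/-- **`#H¹(I_w, M[p]) ≤ #(M[p])^{I_{K_w}}`** for GreenbergSelmer's inertia group
`inertia w = res (absInertia K_w) ≤ Γ_K`, `w ∤ p`, `M[p]` finite of `p`-power order, open stabilisers:
the tree's sharp local bound `natCard_continuousCohomology_one_absInertia_le_natCard_invariants`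
(`#H¹(I_F, B) ≤ #B^{I_F}`, `#B` prime to the residue characteristic) for `B = M[p]` with the
`Γ_{K_w}`-action through `absGaloisRestrict`, and the injectivity of inflation along
`absInertia K_w ↠ inertia w`. [cite: MilneADT2006, I §2 Lemma 2.9] [cite: SerreLocalFields1979, Ch. XIII §1 Prop. 1] -/
theorem natCard_discreteH1_inertia_torsionBy_le [Fact p.Prime] [Finite ↥(M[(p : ℤ)])]
    (hcard : ∃ k : ℕ, Nat.card ↥(M[(p : ℤ)]) = p ^ k)
    (hstab : ∀ m : M,
      IsOpen (MulAction.stabilizer (absoluteGaloisGroup K) m : Set (absoluteGaloisGroup K)))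
    (hpv : (p : 𝓞 K) ∉ v.asIdeal) :
    Finite (discreteH1 (inertia (K := K) v) ↥(M[(p : ℤ)])) ∧
    Nat.card (discreteH1 (inertia (K := K) v) ↥(M[(p : ℤ)])) ≤
      Nat.card {b : ↥(M[(p : ℤ)]) // ∀ σ : absoluteGaloisGroup (v.adicCompletion K),
        σ ∈ absInertia (v.adicCompletion K) →
          absGaloisRestrict K (v.adicCompletion K) σ • b = b} := by
  have hp : (p : ℕ).Prime := Fact.out
  letI : DistribMulAction (absoluteGaloisGroup (v.adicCompletion K)) ↥(M[(p : ℤ)]) :=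
    DistribMulAction.compHom _ (absGaloisRestrict K (v.adicCompletion K)).toMonoidHom
  have hcont : ∀ b : ↥(M[(p : ℤ)]), Continuous fun σ : absoluteGaloisGroup K ↦ σ • b := fun b ↦
    continuous_of_injective_comp (ι := ((↑) : ↥(M[(p : ℤ)]) → M)) Subtype.val_injective
      (by
        change Continuous fun σ : absoluteGaloisGroup K ↦ ((σ • b : ↥(M[(p : ℤ)])) : M)
        exact continuous_smul_of_isOpen_stabilizer (b : M) (hstab b))
  let ρ : ContinuousRep (absoluteGaloisGroup (v.adicCompletion K)) ℤ ↥(M[(p : ℤ)]) :=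
    { toRepresentation :=
        (discreteContRep (absoluteGaloisGroup (v.adicCompletion K)) ↥(M[(p : ℤ)])).toRepresentation
      continuous_smul := by
        refine continuous_prod_of_discrete_right.mpr fun b ↦ ?_
        change Continuous fun σ : absoluteGaloisGroup (v.adicCompletion K) ↦
          absGaloisRestrict K (v.adicCompletion K) σ • b
        exact (hcont b).comp (absGaloisRestrict K (v.adicCompletion K)).continuous_toFun }
  have hbridge : (ρ.restrict (Literature.NumberTheory.GaloisRepresentations.subgroupIncl
      (absInertia (v.adicCompletion K)))).toTopRep =
      discreteTopRep (absInertia (v.adicCompletion K)) ↥(M[(p : ℤ)]) :=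
    rfl
  obtain ⟨k, hk⟩ := hcard
  have hℓ := ringChar_residueField_prime (F := v.adicCompletion K)
  have hne := v.ringChar_residueField_adicCompletion_ne hpv
  have hfin := (natCard_continuousCohomology_one_absInertia_le (v.adicCompletion K) ρ (by
      rw [hk]
      exact ((Nat.coprime_primes hp hℓ).2 (Ne.symm hne)).pow_left k)).1
  have hle := natCard_continuousCohomology_one_absInertia_le_natCard_invariants
    (v.adicCompletion K) ρ (by
      rw [hk]
      exact ((Nat.coprime_primes hp hℓ).2 (Ne.symm hne)).pow_left k)
  rw [hbridge] at hfin hle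
  -- inflation along `absInertia K_v ↠ inertia v`
  let θ : absInertia (v.adicCompletion K) →ₜ* inertia (K := K) v :=
    { toFun := fun x ↦ ⟨absGaloisRestrict K (v.adicCompletion K) x, Subgroup.mem_map_of_mem _ x.2⟩
      map_one' := Subtype.ext (by simp)
      map_mul' := fun x y ↦ Subtype.ext (by simp)
      continuous_toFun :=
        ((absGaloisRestrict K (v.adicCompletion K)).continuous_toFun.comp
          continuous_subtype_val).subtype_mk _ }
  have hθ : Function.Surjective θ := by
    rintro ⟨y, hy⟩
    obtain ⟨x, hx, rfl⟩ := Subgroup.mem_map.1 hy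
    exact ⟨⟨x, hx⟩, rfl⟩
  have hinj : Function.Injective
      ⇑(resH1Hom θ (AddMonoidHom.id ↥(M[(p : ℤ)])) (fun _ _ ↦ rfl) :
        discreteH1 (inertia (K := K) v) ↥(M[(p : ℤ)]) →+
          discreteH1 (absInertia (v.adicCompletion K)) ↥(M[(p : ℤ)])) :=
    Iwasawa.resH1Hom_injective_of_surjective θ hθ fun _ _ ↦ rfl
  haveI := hfin
  refine ⟨Finite.of_injective _ hinj, (Nat.card_le_card_of_injective _ hinj).trans (hle.trans ?_)⟩
  exact le_of_eq (Nat.card_congr (Equiv.refl _))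

end Local

/-! ## §2. `#{x ∈ H¹(inertiaIn H w, M) : p x = 0} ≤ #(M[p])^{I_{K_w}}` for `H = ker κ` -/

section Tower

variable {K : Type u} [Field K] [NumberField K] {M : Type u} [AddCommGroup M]
  [DistribMulAction (absoluteGaloisGroup K) M] [TopologicalSpace M] [DiscreteTopology M]
  {p : ℕ} [Fact p.Prime] (κ : ZpExtension K p) (v : HeightOneSpectrum (𝓞 K))

/-- **`#{x ∈ H¹(inertiaIn H w, M) : p • x = 0} ≤ #(M[p])^{I_{K_w}}`** for `H = ker κ`, ANY
`ℤ_p`-extension `κ` of the number field `K`, `w ∤ p`, and a `p`-divisible discrete `Γ_K`-module `M`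
with open stabilisers and finite `p`-torsion of `p`-power order. Chain (the cardinality form of
k5-c2 g11's `finite_setOf_nsmul_eq_zero_discreteH1_inertiaIn`): `H¹(inertiaIn H w, M) ↪ H¹(H ⊓ I_w, M)`,
`H ⊓ I_w = I_w` (`ℤ_p`-extensions are unramified outside `p`), Kummer `H¹(I_w, M[p]) ↠ H¹(I_w, M)[p]`
(`exists_torsionBy_lift`), and §1. This is the per-place input of Greenberg–Vatsal's corank
computation `corank H¹(I_η, A) ≤ corank A(I_η-invariants)`. [cite: GreenbergVatsal2000, §2 pp. 17, 22–23]
[cite: MilneADT2006, I §2 Lemma 2.9] -/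
theorem natCard_setOf_nsmul_eq_zero_discreteH1_inertiaIn_le [Finite ↥(M[(p : ℤ)])]
    (hcard : ∃ k : ℕ, Nat.card ↥(M[(p : ℤ)]) = p ^ k)
    (hdiv : ∀ m : M, ∃ m' : M, p • m' = m)
    (hstab : ∀ m : M,
      IsOpen (MulAction.stabilizer (absoluteGaloisGroup K) m : Set (absoluteGaloisGroup K)))
    (hpv : (p : 𝓞 K) ∉ v.asIdeal) :
    Set.Finite {x : discreteH1 (inertiaIn κ.kerSubgroup v) M | p • x = 0} ∧
    Nat.card {x : discreteH1 (inertiaIn κ.kerSubgroup v) M | p • x = 0} ≤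
      Nat.card {b : ↥(M[(p : ℤ)]) // ∀ σ : absoluteGaloisGroup (v.adicCompletion K),
        σ ∈ absInertia (v.adicCompletion K) →
          absGaloisRestrict K (v.adicCompletion K) σ • b = b} := by
  refine ⟨finite_setOf_nsmul_eq_zero_discreteH1_inertiaIn κ v hcard hdiv hstab hpv, ?_⟩
  set H := κ.kerSubgroup with hH
  -- the three comparison maps
  obtain ⟨r₁, hr₁⟩ := Iwasawa.exists_injective_discreteH1_inertiaIn_to_inf (K := K) v H M
  have hle : inertia (K := K) v ≤ H ⊓ inertia (K := K) v :=
    le_inf (Iwasawa.inertia_le_kerSubgroup' κ v hpv) le_rfl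
  let r₂ : subgroupH1 (H ⊓ inertia (K := K) v) ↥(M[(p : ℤ)]) →+
      subgroupH1 (inertia (K := K) v) ↥(M[(p : ℤ)]) :=
    resOfLe (↥(M[(p : ℤ)])) hle
  have hr₂ : Function.Injective r₂ := by
    refine Function.LeftInverse.injective
      (g := resOfLe (↥(M[(p : ℤ)])) (inf_le_right : H ⊓ inertia (K := K) v ≤ _)) fun c ↦ ?_
    rw [← AddMonoidHom.comp_apply, resOfLe_comp_holds, resOfLe_refl_holds, AddMonoidHom.id_apply]
  -- finiteness along the chain
  obtain ⟨hfinI, hcardI⟩ := natCard_discreteH1_inertia_torsionBy_le p v hcard hstab hpv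
  haveI := hfinI
  haveI hfin₂ : Finite (subgroupH1 (H ⊓ inertia (K := K) v) ↥(M[(p : ℤ)])) :=
    Finite.of_injective _ hr₂
  -- (a) Kummer: the `p`-torsion of `H¹(H ⊓ I_v, M)` is covered by `H¹(H ⊓ I_v, M[p])`
  let kum : subgroupH1 (H ⊓ inertia (K := K) v) ↥(M[(p : ℤ)]) →+
      subgroupH1 (H ⊓ inertia (K := K) v) M :=
    resH1Hom (ContinuousMonoidHom.id _) (M[(p : ℤ)]).subtype (fun _ _ ↦ rfl)
  let T₂ := {y : subgroupH1 (H ⊓ inertia (K := K) v) M // p • y = 0}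
  have hlift : ∀ y : T₂, ∃ z : subgroupH1 (H ⊓ inertia (K := K) v) ↥(M[(p : ℤ)]), kum z = y.1 :=
    fun y ↦ exists_torsionBy_lift p (H ⊓ inertia (K := K) v) hdiv hstab y.2
  choose g hg using hlift
  have hginj : Function.Injective g := fun y z hyz ↦ by
    apply Subtype.ext
    rw [← hg y, ← hg z, hyz]
  haveI hfinT₂ : Finite T₂ := Finite.of_injective g hginj
  have h2 : Nat.card T₂ ≤ Nat.card (subgroupH1 (H ⊓ inertia (K := K) v) ↥(M[(p : ℤ)])) :=
    Nat.card_le_card_of_injective g hginj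
  -- (b) `T ↪ T₂` along `r₁`
  let T := {x : discreteH1 (inertiaIn H v) M | p • x = 0}
  let f₁ : T → T₂ := fun x ↦ ⟨r₁ x.1, by
    change p • r₁ x.1 = 0
    rw [← map_nsmul, (x.2 : p • x.1 = 0), map_zero]⟩
  have hf₁ : Function.Injective f₁ := fun x y hxy ↦ by
    apply Subtype.ext
    exact hr₁ (congrArg Subtype.val hxy)
  have h1 : Nat.card T ≤ Nat.card T₂ := Nat.card_le_card_of_injective f₁ hf₁
  -- (c) `H¹(H ⊓ I_v, M[p]) ↪ H¹(I_v, M[p])`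
  have h3 : Nat.card (subgroupH1 (H ⊓ inertia (K := K) v) ↥(M[(p : ℤ)])) ≤
      Nat.card (discreteH1 (inertia (K := K) v) ↥(M[(p : ℤ)])) :=
    Nat.card_le_card_of_injective r₂ hr₂
  exact h1.trans (h2.trans (h3.trans hcardI))

/-! ## §3. The per-place corank bounds `c_w` -/

omit [TopologicalSpace M] [DiscreteTopology M] [Fact p.Prime] in
/-- The invariants `(M[p])^{I_{K_w}}` embed in `M[p]`; so the bound of §2 is at most `#M[p]`.
[cite: MilneADT2006, I §2 Lemma 2.9] -/
theorem natCard_invariants_le [Finite ↥(M[(p : ℤ)])] :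
    Nat.card {b : ↥(M[(p : ℤ)]) // ∀ σ : absoluteGaloisGroup (v.adicCompletion K),
        σ ∈ absInertia (v.adicCompletion K) →
          absGaloisRestrict K (v.adicCompletion K) σ • b = b} ≤ Nat.card ↥(M[(p : ℤ)]) :=
  Nat.card_le_card_of_injective _ Subtype.val_injective

/-- **`c_w ≤ 1` when `#M[p] = p`.** For every subgroup `Y ≤ H¹(inertiaIn H w, M)` (`H = ker κ`,
`w ∤ p`, `M` as in §2 with `#M[p] = p`): `Y[p]` is finite of order `≤ p`, hence `zpCorank Y p ≤ 1`
(`NonPrimitiveQuotientCorank.zpCorank_le_one_of_natCard_torsionBy_le`). Greenberg–Vatsal Prop. (2.4):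
the local factor of a rank-one module has corank `≤ 1` per place. [cite: GreenbergVatsal2000, §2 Prop. (2.4) pp. 22–23] -/
theorem zpCorank_le_one_of_natCard_torsionBy_eq [Finite ↥(M[(p : ℤ)])]
    (hcard : Nat.card ↥(M[(p : ℤ)]) = p)
    (hdiv : ∀ m : M, ∃ m' : M, p • m' = m)
    (hstab : ∀ m : M,
      IsOpen (MulAction.stabilizer (absoluteGaloisGroup K) m : Set (absoluteGaloisGroup K)))
    (hpv : (p : 𝓞 K) ∉ v.asIdeal) (Y : AddSubgroup (discreteH1 (inertiaIn κ.kerSubgroup v) M)) :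
    Finite ((↥Y)[(p : ℤ)]) ∧ zpCorank Y p ≤ 1 := by
  obtain ⟨hfin, hle⟩ := natCard_setOf_nsmul_eq_zero_discreteH1_inertiaIn_le κ v
    ⟨1, by rw [hcard, pow_one]⟩ hdiv hstab hpv
  haveI := hfin.to_subtype
  let f : (↥Y)[(p : ℤ)] → {x : discreteH1 (inertiaIn κ.kerSubgroup v) M | p • x = 0} := fun y ↦
    ⟨((y : Y) : discreteH1 (inertiaIn κ.kerSubgroup v) M), by
      have h := AddSubgroup.torsionBy.nsmul_iff.1 y.2
      change p • ((y : Y) : discreteH1 (inertiaIn κ.kerSubgroup v) M) = 0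
      rw [← AddSubmonoidClass.coe_nsmul, h, ZeroMemClass.coe_zero]⟩
  have hf : Function.Injective f := fun y z hyz ↦ by
    have h := Subtype.ext_iff.mp hyz
    exact Subtype.ext (Subtype.ext h)
  haveI hfinY : Finite ((↥Y)[(p : ℤ)]) := Finite.of_injective f hf
  refine ⟨hfinY, zpCorank_le_one_of_natCard_torsionBy_le ?_⟩
  calc Nat.card ((↥Y)[(p : ℤ)]) ≤ Nat.card {x : discreteH1 (inertiaIn κ.kerSubgroup v) M | p • x = 0} :=
        Nat.card_le_card_of_injective f hf
    _ ≤ _ := hle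
    _ ≤ Nat.card ↥(M[(p : ℤ)]) := natCard_invariants_le v
    _ = p := hcard

/-- **`c_w = 0` when the local inertia group has no non-zero fixed point on `M[p]`** (e.g. a
residually RAMIFIED character): every subgroup `Y ≤ H¹(inertiaIn H w, M)` has `Y[p] = 0`, hence
`zpCorank Y p = 0` (`zpCorank_eq_zero_of_torsionBy_trivial`). Greenberg–Vatsal Prop. (2.4) / KY
Lemma 1.1.1 in the case `F(θ)_{I_w} = 0` (`𝒫_w(θ) = 1`). [cite: GreenbergVatsal2000, §2 Prop. (2.4) pp. 22–23]
[cite: KellerYin2024, Lemma 1.1.1 (arXiv:2402.12781v2 TeX L455–462)] -/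
theorem zpCorank_eq_zero_of_invariants_trivial [Finite ↥(M[(p : ℤ)])]
    (hcard : ∃ k : ℕ, Nat.card ↥(M[(p : ℤ)]) = p ^ k)
    (hdiv : ∀ m : M, ∃ m' : M, p • m' = m)
    (hstab : ∀ m : M,
      IsOpen (MulAction.stabilizer (absoluteGaloisGroup K) m : Set (absoluteGaloisGroup K)))
    (hpv : (p : 𝓞 K) ∉ v.asIdeal)
    (hinv : ∀ b : ↥(M[(p : ℤ)]), (∀ σ : absoluteGaloisGroup (v.adicCompletion K),
        σ ∈ absInertia (v.adicCompletion K) →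
          absGaloisRestrict K (v.adicCompletion K) σ • b = b) → b = 0)
    (Y : AddSubgroup (discreteH1 (inertiaIn κ.kerSubgroup v) M)) :
    zpCorank Y p = 0 := by
  obtain ⟨hfin, hle⟩ := natCard_setOf_nsmul_eq_zero_discreteH1_inertiaIn_le κ v hcard hdiv hstab hpv
  haveI := hfin.to_subtype
  -- the invariants are a singleton, so `{x | p x = 0}` is a singleton
  haveI hsub : Subsingleton {b : ↥(M[(p : ℤ)]) // ∀ σ : absoluteGaloisGroup (v.adicCompletion K),
      σ ∈ absInertia (v.adicCompletion K) →
        absGaloisRestrict K (v.adicCompletion K) σ • b = b} :=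
    ⟨fun x y ↦ Subtype.ext ((hinv x.1 x.2).trans (hinv y.1 y.2).symm)⟩
  have h1 : Nat.card {x : discreteH1 (inertiaIn κ.kerSubgroup v) M | p • x = 0} ≤ 1 :=
    hle.trans (Finite.card_le_one_iff_subsingleton.mpr hsub)
  have hzero : ∀ x : discreteH1 (inertiaIn κ.kerSubgroup v) M, p • x = 0 → x = 0 := by
    intro x hx
    have hss : Subsingleton {x : discreteH1 (inertiaIn κ.kerSubgroup v) M | p • x = 0} :=
      (Finite.card_le_one_iff_subsingleton).mp h1
    have h0 : (⟨x, hx⟩ : {x : discreteH1 (inertiaIn κ.kerSubgroup v) M | p • x = 0}) =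
        ⟨0, (smul_zero _ : p • (0 : discreteH1 (inertiaIn κ.kerSubgroup v) M) = 0)⟩ :=
      Subsingleton.elim _ _
    exact congrArg Subtype.val h0
  refine zpCorank_eq_zero_of_torsionBy_trivial fun y hy ↦ Subtype.ext (hzero _ ?_)
  rw [← AddSubmonoidClass.coe_nsmul, hy, ZeroMemClass.coe_zero]

end Tower

end Summit.BirchSwinnertonDyer.BirchSwinnertonDyer.Theorems.InertiaTorsionCardGeneric

end
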